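import Summits.CriticalPhenomena.PercolationContinuityZ3.Theorems.Transplant.FKConnectivityAllQAntipodalRootFormCertSer

/-!
# Connectivity correlation inequalities for `φ_{w,q}`, every `q > 0` — ROOT-FORM CALCULUS, file 61h: the certificate of base (B3) (a parallel
# edge over the SERIES pair, `g ∥ (B_y · B_z)`, four sub-slots) as a kernel-checked table

Support file (`--supports stmt-CriticalPhenomena-4575`), FK sub-lane `prim-bschramm-fk-2` (gen 28); builds on p205010 (kernel theorem, internal audit
signed; external expert review pending).  Standard axioms, no sorries.  Memo FROM-fk-2-g28-ROOT-FORM.md §6 (certificate kit j207955: 84 single-box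
instances with multipliers in {1/4,1/2,3/4,1} plus the two middle-slot contracted-AND terms; here scaled by 4) and §7.

The environment `g ∥ (B_y·B_z)` has configurations `(b, β, γ)`; the nested root functional splits into four SUB-SLOTS `(i, b)` (slot × state of `g`)
ordered `00 < 01 < 11`, `00 < 10 < 11`.  Type-level data at sub-slot state `b`: level `Λ_S + K¹_S` / `Λ_S + K²_S`, pole bits `(1, K²_S)` / `(K¹_S, 1)`.
Targets `X3 i b`, certificate `certY3, certZ3` (components for the sub-slots 11, 10, 01, 00), the pair terms `4·ANDconS` on 10 and 01, residual `rho3`,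
and `rho3_nonneg`: the FIVE up-set conditions of the sub-slot poset (`ρ₁₁ ≥ 0`, `ρ₁₁+ρ₁₀ ≥ 0`, `ρ₁₁+ρ₀₁ ≥ 0`, `ρ₁₁+ρ₁₀+ρ₀₁ ≥ 0`, `Σ ≥ 0`) for all
consistent type pairs and all offsets (window by `decide +kernel`, saturation outside). [folklore]
-/

namespace Summit.CriticalPhenomena.PercolationContinuityZ3.Theorems

namespace FK

namespace RootForm

namespace Cert

/-- level of `g ∥ (B_y·B_z)` at `g`-state `b` and box states `(a,c)`, relative to `L⁰_y + L⁰_z`. [folklore] -/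
def lam3 (b : Bool) (ty tz : BT) (a c : Bool) : ℤ := plamS ty tz a c + (if b then C1S ty tz a c else C2S ty tz a c)
/-- replica-1 pole bit of `g ∥ (B_y·B_z)` at `g`-state `b`. [folklore] -/
def K13 (b : Bool) (ty tz : BT) (a c : Bool) : ℤ := if b then 1 else C1S ty tz a c
/-- replica-2 pole bit of `g ∥ (B_y·B_z)` at `g`-state `b`. [folklore] -/
def K23 (b : Bool) (ty tz : BT) (a c : Bool) : ℤ := if b then C2S ty tz a c else 1
/-- slot-1 integrand of the nested root functional of `g ∥ (B_y·B_z)` at `g`-state `b`. [folklore] -/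
def X31 (b : Bool) (ty tz : BT) (k : ℤ) : ℤ :=
  I (lam3 b ty tz false false + K13 b ty tz false false ≤ k) - I (lam3 b ty tz true true + K13 b ty tz true true ≤ k)
  + I (lam3 b ty tz true false = k) * K13 b ty tz true false + I (lam3 b ty tz false true = k) * K13 b ty tz false true
/-- slot-0 integrand at `g`-state `b`. [folklore] -/
def X30 (b : Bool) (ty tz : BT) (k : ℤ) : ℤ :=
  I (lam3 b ty tz false false + K23 b ty tz false false ≤ k) - I (lam3 b ty tz true true + K23 b ty tz true true ≤ k)
  - I (lam3 b ty tz true false = k) * K23 b ty tz true false - I (lam3 b ty tz false true = k) * K23 b ty tz false true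
/-- contracted AND of the series pair: `[Λ_∅+K¹_∅+K²_∅ ≤ k] − [Λ_yz+K¹_yz+K²_yz ≤ k]`. [folklore] -/
def ANDconS (ty tz : BT) (k : ℤ) : ℤ :=
  I (plamS ty tz false false + C1S ty tz false false + C2S ty tz false false ≤ k)
  - I (plamS ty tz true true + C1S ty tz true true + C2S ty tz true true ≤ k)

/-- y-side of the (B3) certificate ×4 (components for the sub-slots 11, 10, 01, 00); thresholds `K0m = k − 1`, `K1m = k − dL_z − 1`. [folklore] -/
def certY3 (ty tz : BT) (K0m K1m : ℤ) : ℤ × ℤ × ℤ × ℤ :=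
  ((2 * isC tz false false false false * A2 ty K0m + 2 * isC tz false false true false * A2 ty K0m + isC tz false false true true * A2 ty K0m + 2 * isC tz false true false false * A2 ty K0m + isC tz false true true true * A2 ty K0m + 2 * isC tz true true false false * A2 ty K1m + 2 * isC tz false false true true * A3u ty K1m + 2 * isC tz true true false false * A3u ty K0m + 2 * isC tz true true true false * A3u ty K0m + 2 * isC tz true true true true * A3u ty K0m + 2 * isC tz true true true false * A4u ty K0m + 2 * isC tz true true true true * A4u ty K1m + 2 * isC tz false false true false * A4u ty K0m + isC tz false false true true * A4u ty K0m + isC tz false true true true * A4u ty K0m + 2 * isC tz true true true true * A4u ty K0m),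
    (2 * isC tz false false false false * A2 ty K0m + 2 * isC tz false false true false * A2 ty K1m + isC tz false false true true * A2 ty K0m + isC tz false false true true * A4u ty K0m + isC tz false false true true * A4l ty K0m + 2 * isC tz false false true false * A4l ty K0m + isC tz false false true true * A4l ty K0m + isC tz false true true true * A4l ty K0m + 2 * isC tz true true true true * A4l ty K0m),
    (2 * isC tz false false false false * A2 ty K1m + 2 * isC tz false true false false * A2 ty K0m + 4 * isC tz false true true false * A2 ty K0m + isC tz false true true true * A2 ty K0m + 2 * isC tz true true true false * A2 ty K1m + 2 * isC tz false true true true * A3u ty K1m + 2 * isC tz true true true true * A3u ty K1m + 2 * isC tz false true true true * A4u ty K1m + 2 * isC tz false true true true * A4l ty K1m + 2 * isC tz true true true false * A4u ty K1m + 2 * isC tz true true true false * A4l ty K1m + 2 * isC tz false true false false * A4u ty K1m + 4 * isC tz false true true false * A4u ty K0m + isC tz false true true true * A4u ty K0m + 2 * isC tz true true false false * A4u ty K1m),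
    (2 * isC tz false false false false * A2 ty K1m + 2 * isC tz false false true false * A2 ty K0m + 2 * isC tz false false true false * A2 ty K1m + 2 * isC tz false false true true * A2 ty K0m + 4 * isC tz false true false false * A2 ty K1m + 4 * isC tz false true true false * A2 ty K0m + 2 * isC tz false true true true * A2 ty K0m + 2 * isC tz true true false false * A2 ty K1m + 2 * isC tz true true true false * A2 ty K1m + 2 * isC tz false true true true * A3l ty K1m + 2 * isC tz true true true true * A3l ty K1m + 2 * isC tz false false true true * A3l ty K1m + 2 * isC tz true true false false * A3l ty K0m + 2 * isC tz true true true false * A3l ty K0m + 2 * isC tz true true true true * A3l ty K0m + 2 * isC tz false true false false * A4l ty K1m + 4 * isC tz false true true false * A4l ty K0m + isC tz false true true true * A4l ty K0m + 2 * isC tz true true false false * A4l ty K1m + 2 * isC tz true true true false * A4l ty K0m + 2 * isC tz true true true true * A4l ty K1m))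

/-- z-side of the (B3) certificate ×4; thresholds `K0m = k − 1`, `K1m = k − dL_y − 1`. [folklore] -/
def certZ3 (ty tz : BT) (K0m K1m : ℤ) : ℤ × ℤ × ℤ × ℤ :=
  ((3 * isC ty false false false false * A2 tz K0m + 2 * isC ty false false true false * A2 tz K0m + 2 * isC ty false false true false * A2 tz K1m + 2 * isC ty false false true true * A2 tz K0m + 2 * isC ty false true false false * A2 tz K0m + 2 * isC ty false true false false * A2 tz K1m + 4 * isC ty false true true false * A2 tz K0m + 2 * isC ty false true true true * A2 tz K0m + 2 * isC ty true true false false * A2 tz K1m + 2 * isC ty false true true true * A3u tz K1m + 2 * isC ty true true false false * A3u tz K0m + 2 * isC ty true true true false * A3u tz K0m + 2 * isC ty true true true true * A3u tz K0m + 2 * isC ty false true false false * A4u tz K1m + 2 * isC ty false true false false * A4l tz K1m + 2 * isC ty false true true false * A4u tz K0m + 2 * isC ty false true true false * A4l tz K0m + 2 * isC ty false true true true * A4u tz K1m + 2 * isC ty false true true true * A4l tz K1m + 2 * isC ty true true false false * A4u tz K1m + 2 * isC ty true true false false * A4l tz K1m + 2 * isC ty true true true false * A4u tz K1m + 2 *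 isC ty true true true false * A4l tz K1m + 2 * isC ty true true true true * A4u tz K1m + 2 * isC ty true true true true * A4l tz K1m + 2 * isC ty true true true false * A4u tz K0m),
    (isC ty false false false false * A2 tz K0m + 2 * isC ty false false true true * A2 tz K0m + 2 * isC ty false true true false * A2 tz K0m + 2 * isC ty true true false false * A3l tz K0m + 2 * isC ty true true true false * A3l tz K0m + 2 * isC ty true true true true * A3l tz K0m + 2 * isC ty true true true true * A4u tz K0m),
    (2 * isC ty false true false false * A2 tz K0m + 2 * isC ty true true true false * A2 tz K1m + 2 * isC ty false false true true * A3u tz K1m + 2 * isC ty true true true true * A3u tz K1m),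
    (4 * isC ty false false false false * A2 tz K1m + 2 * isC ty false false true false * A2 tz K0m + 2 * isC ty false false true false * A2 tz K1m + 2 * isC ty false true false false * A2 tz K1m + 2 * isC ty false true true false * A2 tz K0m + 2 * isC ty false true true true * A2 tz K0m + 2 * isC ty true true false false * A2 tz K1m + 2 * isC ty true true true false * A2 tz K1m + 2 * isC ty false false true true * A3l tz K1m + 2 * isC ty true true true true * A3l tz K1m + 2 * isC ty false true true true * A3l tz K1m + 2 * isC ty false false true false * A4u tz K0m + 2 * isC ty false false true false * A4l tz K0m + 2 * isC ty false false true true * A4u tz K0m + 2 * isC ty false false true true * A4l tz K0m + 2 * isC ty false true true false * A4u tz K0m + 2 * isC ty false true true false * A4l tz K0m + 2 * isC ty false true true true * A4u tz K0m + 2 * isC ty false true true true * A4l tz K0m + 2 * isC ty true true true true * A4l tz K0m + 2 * isC ty true true true false * A4l tz K0m))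

/-- residual ×4 of the (B3) certificate (components 11, 10, 01, 00); the pair terms `4·ANDconS` sit on 10 and 01. [folklore] -/
def rho3 (ty tz : BT) (k : ℤ) : ℤ × ℤ × ℤ × ℤ :=
  let y := certY3 ty tz (k - 1) (k - tz.dL - 1)
  let z := certZ3 ty tz (k - 1) (k - ty.dL - 1)
  (4 * X31 true ty tz k - y.1 - z.1,
   4 * X31 false ty tz k - y.2.1 - z.2.1 - 4 * ANDconS ty tz k,
   4 * X30 true ty tz k - y.2.2.1 - z.2.2.1 - 4 * ANDconS ty tz k,
   4 * X30 false ty tz k - y.2.2.2 - z.2.2.2)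

/-- the five up-set conditions of the sub-slot poset at one row. [folklore] -/
def checkRow3 (ty tz : BT) (k : ℤ) : Bool :=
  let r := rho3 ty tz k
  decide (0 ≤ r.1) && decide (0 ≤ r.1 + r.2.1) && decide (0 ≤ r.1 + r.2.2.1) && decide (0 ≤ r.1 + r.2.1 + r.2.2.1)
    && decide (0 ≤ r.1 + r.2.1 + r.2.2.1 + r.2.2.2)

/-- all rows of the window. [folklore] -/
def checkAll3 : Bool := T21.all fun ty => T21.all fun tz => ks.all fun k => checkRow3 ty tz k

/-- **The (B3) certificate is valid on the window.** [folklore] -/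
theorem checkAll3_true : checkAll3 = true := by decide +kernel

/-- Residual conditions inside the window. [folklore] -/
theorem rho3_window (ty tz : BT) (hy : consistentB ty = true) (hz : consistentB tz = true) (k : ℤ) (h1 : -8 ≤ k) (h2 : k ≤ 9) :
    0 ≤ (rho3 ty tz k).1 ∧ 0 ≤ (rho3 ty tz k).1 + (rho3 ty tz k).2.1 ∧ 0 ≤ (rho3 ty tz k).1 + (rho3 ty tz k).2.2.1
      ∧ 0 ≤ (rho3 ty tz k).1 + (rho3 ty tz k).2.1 + (rho3 ty tz k).2.2.1
      ∧ 0 ≤ (rho3 ty tz k).1 + (rho3 ty tz k).2.1 + (rho3 ty tz k).2.2.1 + (rho3 ty tz k).2.2.2 := by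
  have h := checkAll3_true
  rw [checkAll3, List.all_eq_true] at h
  have h' := h ty (mem_T21 ty hy); rw [List.all_eq_true] at h'
  have h'' := h' tz (mem_T21 tz hz); rw [List.all_eq_true] at h''
  have h3 := h'' k (mem_ks k h1 h2)
  simp only [checkRow3, Bool.and_eq_true, decide_eq_true_eq] at h3
  exact ⟨h3.1.1.1.1, h3.1.1.1.2, h3.1.1.2, h3.1.2, h3.2⟩

/-- bounds of the level at a `g`-state. [folklore] -/
theorem lam3_bound (b : Bool) (ty tz : BT) (hy : -1 ≤ ty.dL ∧ ty.dL ≤ 1) (hz : -1 ≤ tz.dL ∧ tz.dL ≤ 1) (a c : Bool) :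
    -2 ≤ lam3 b ty tz a c ∧ lam3 b ty tz a c ≤ 3 := by
  have h1 := plamS_bound ty tz hy hz a c; have h2 := C1S_bound ty tz a c; have h3 := C2S_bound ty tz a c
  unfold lam3; cases b <;> simp <;> omega
/-- bounds of the pole bits at a `g`-state. [folklore] -/
theorem K13_bound (b : Bool) (ty tz : BT) (a c : Bool) : 0 ≤ K13 b ty tz a c ∧ K13 b ty tz a c ≤ 1 := by
  have h2 := C1S_bound ty tz a c
  cases b
  · simpa [K13] using h2
  · simp [K13]
/-- see `K13_bound`. [folklore] -/
theorem K23_bound (b : Bool) (ty tz : BT) (a c : Bool) : 0 ≤ K23 b ty tz a c ∧ K23 b ty tz a c ≤ 1 := by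
  have h2 := C2S_bound ty tz a c
  cases b
  · simp [K23]
  · simpa [K23] using h2
/-- `X31` vanishes far from the support. [folklore] -/
theorem X31_sat (b : Bool) (ty tz : BT) (hy : -1 ≤ ty.dL ∧ ty.dL ≤ 1) (hz : -1 ≤ tz.dL ∧ tz.dL ≤ 1) (k : ℤ) (hk : k ≤ -5 ∨ 6 ≤ k) :
    X31 b ty tz k = 0 := by
  have p00 := lam3_bound b ty tz hy hz false false; have p11 := lam3_bound b ty tz hy hz true true
  have p10 := lam3_bound b ty tz hy hz true false; have p01 := lam3_bound b ty tz hy hz false true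
  have c00 := K13_bound b ty tz false false; have c11 := K13_bound b ty tz true true
  unfold X31; rcases hk with hk | hk
  · rw [I_le_false (by omega), I_le_false (by omega), I_eq_false (by omega), I_eq_false (by omega)]; simp
  · rw [I_le_true (by omega), I_le_true (by omega), I_eq_false (by omega), I_eq_false (by omega)]; simp
/-- `X30` vanishes far from the support. [folklore] -/
theorem X30_sat (b : Bool) (ty tz : BT) (hy : -1 ≤ ty.dL ∧ ty.dL ≤ 1) (hz : -1 ≤ tz.dL ∧ tz.dL ≤ 1) (k : ℤ) (hk : k ≤ -5 ∨ 6 ≤ k) :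
    X30 b ty tz k = 0 := by
  have p00 := lam3_bound b ty tz hy hz false false; have p11 := lam3_bound b ty tz hy hz true true
  have p10 := lam3_bound b ty tz hy hz true false; have p01 := lam3_bound b ty tz hy hz false true
  have c00 := K23_bound b ty tz false false; have c11 := K23_bound b ty tz true true
  unfold X30; rcases hk with hk | hk
  · rw [I_le_false (by omega), I_le_false (by omega), I_eq_false (by omega), I_eq_false (by omega)]; simp
  · rw [I_le_true (by omega), I_le_true (by omega), I_eq_false (by omega), I_eq_false (by omega)]; simp
/-- `ANDconS` vanishes far from the support. [folklore] -/
theorem ANDconS_sat (ty tz : BT) (hy : -1 ≤ ty.dL ∧ ty.dL ≤ 1) (hz : -1 ≤ tz.dL ∧ tz.dL ≤ 1) (k : ℤ) (hk : k ≤ -5 ∨ 6 ≤ k) :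
    ANDconS ty tz k = 0 := by
  have p00 := plamS_bound ty tz hy hz false false; have p11 := plamS_bound ty tz hy hz true true
  have c00 := C1S_bound ty tz false false; have c11 := C1S_bound ty tz true true
  have d00 := C2S_bound ty tz false false; have d11 := C2S_bound ty tz true true
  unfold ANDconS; rcases hk with hk | hk
  · rw [I_le_false (by omega), I_le_false (by omega)]; simp
  · rw [I_le_true (by omega), I_le_true (by omega)]; simp

/-- Outside the window the (B3) residual vanishes. [folklore] -/
theorem rho3_sat (ty tz : BT) (hy : consistentB ty = true) (hz : consistentB tz = true) (k : ℤ) (hk : k ≤ -9 ∨ 10 ≤ k) :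
    rho3 ty tz k = (0, 0, 0, 0) := by
  have dy := dL_bound ty hy; have dz := dL_bound tz hz
  simp only [rho3, certY3, certZ3, X31_sat _ ty tz dy dz k (by omega), X30_sat _ ty tz dy dz k (by omega), ANDconS_sat ty tz dy dz k (by omega),
    A2_sat ty dy (k - 1) (by omega), A2_sat ty dy (k - tz.dL - 1) (by omega), A2_sat tz dz (k - 1) (by omega), A2_sat tz dz (k - ty.dL - 1) (by omega),
    A3u_sat ty dy (k - 1) (by omega), A3u_sat ty dy (k - tz.dL - 1) (by omega), A3l_sat ty dy (k - 1) (by omega), A3l_sat ty dy (k - tz.dL - 1) (by omega),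
    A3u_sat tz dz (k - 1) (by omega), A3u_sat tz dz (k - ty.dL - 1) (by omega), A3l_sat tz dz (k - 1) (by omega), A3l_sat tz dz (k - ty.dL - 1) (by omega),
    A4u_sat ty dy (k - 1) (by omega), A4u_sat ty dy (k - tz.dL - 1) (by omega), A4l_sat ty (k - 1) (by omega), A4l_sat ty (k - tz.dL - 1) (by omega),
    A4u_sat tz dz (k - 1) (by omega), A4u_sat tz dz (k - ty.dL - 1) (by omega), A4l_sat tz (k - 1) (by omega), A4l_sat tz (k - ty.dL - 1) (by omega)]
  simp

/-- **Residual of the (B3) certificate**: the five up-set conditions for all consistent type pairs and every offset. [folklore] -/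
theorem rho3_nonneg (ty tz : BT) (hy : consistentB ty = true) (hz : consistentB tz = true) (k : ℤ) :
    0 ≤ (rho3 ty tz k).1 ∧ 0 ≤ (rho3 ty tz k).1 + (rho3 ty tz k).2.1 ∧ 0 ≤ (rho3 ty tz k).1 + (rho3 ty tz k).2.2.1
      ∧ 0 ≤ (rho3 ty tz k).1 + (rho3 ty tz k).2.1 + (rho3 ty tz k).2.2.1
      ∧ 0 ≤ (rho3 ty tz k).1 + (rho3 ty tz k).2.1 + (rho3 ty tz k).2.2.1 + (rho3 ty tz k).2.2.2 := by
  by_cases hk : k ≤ -9 ∨ 10 ≤ k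
  · rw [rho3_sat ty tz hy hz k hk]; simp
  · exact rho3_window ty tz hy hz k (by omega) (by omega)

end Cert

end RootForm

end FK

end Summit.CriticalPhenomena.PercolationContinuityZ3.Theorems
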